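import Summits.QuantumFields.YangMills.Theorems.ContinuumLimitOnTrajectory.Negative.UltralocalTwoPoint
import Literature.MathematicalPhysics.QuantumLattice.SchwartzReIm
import Literature.MathematicalPhysics.QuantumLattice.GaugeGroupsProofs

/-!
# `ContinuumLimitOnTrajectory` — negative-side support IV: the ultralocal model has no non-trivial continuum limit; (A) without asymptotic freedom is false

Support file 4/4 for crux `stmt-QuantumFields-10522` ((A) of `ParabolicTrajectory`), from the disprover's work
file §2. Tree objects only (`IsYangMillsFor`, `OSData.IsNontrivial`, `SpeciesScheme`).

* `T1`, `T2`, `isOffDiagonal_T2`, `schwinger_two_eq_mul`: at `β ≡ 0` the continuum two-point function of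
  `tr F²` on time-separated real product tensors factorises for every OS datum tied to the scheme.
* `not_isNontrivial_beta_zero`: hence NO such OS datum is `IsNontrivial r.curvature` — whatever the
  renormalisations `c_k, m_k` and tori (pinning of `Θ F̄ ⊗ G` through four real product tensors).
* `ultralocalScheme`, `ultralocal_counterexample`: `a_k = M^{-k}`, `β ≡ 0`, `L_k = M^k (k+1)` meets the
  `M`-adic shape, the convergence of every `N_t` (to `0`), the tuning clause with `θ = 0` and the uniform
  lattice gap for every `Δ ≥ 0`, and no renormalisation of it carries non-trivial Yang–Mills OS data.
* `continuumLimitOnTrajectory_of_without_AF`, `continuumLimitOnTrajectory_false_without_AF`: the crux with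
  its clause `Tendsto sch.β atTop atTop` dropped and `0 < θ` widened to `0 ≤ θ` implies the crux and is
  FALSE (witness `G = SU(2)`): the pair {AF clause, `θ > 0`} is load-bearing in (A).
-/

namespace Summit.QuantumFields.YangMills.Theorems.ContinuumLimitOnTrajectory.Negative

open MeasureTheory Filter Topology
open Literature.MathematicalPhysics.QuantumFieldTheory Literature.MathematicalPhysics.QuantumLattice
open Literature.Probability.LatticeModels (Torus.proj Torus.proj_apply)

noncomputable section

section Pinning

open scoped SchwartzMap ComplexConjugate
open Literature.MathematicalPhysics.AQFT (IsOffDiagonal coincidenceLocus)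
open Complex

variable {G : Type} [Group G] [TopologicalSpace G] [IsTopologicalGroup G] [CompactSpace G]
  [MeasurableSpace G] [BorelSpace G]

local notation "E⁴" => EuclideanSpace ℝ (Fin 4)

/-! ### Real one- and two-variable product tensors -/

/-- The one-variable tensor of a real test function, complexified. [folklore] -/
def T1 (u : 𝓢(E⁴, ℝ)) : 𝓢((Fin 1 → E⁴), ℂ) := SchwartzMap.tensorFin 1 fun i => ofRealTest (![u] i)

/-- The two-variable product tensor `u ⊗ v` of real test functions, complexified. [folklore] -/
def T2 (u v : 𝓢(E⁴, ℝ)) : 𝓢((Fin (1 + 1) → E⁴), ℂ) :=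
  SchwartzMap.tensorFin (1 + 1) fun i => ofRealTest (![u, v] i)

/-- Values of the one-variable tensor. [folklore] -/
theorem T1_apply (u : 𝓢(E⁴, ℝ)) (y : Fin 1 → E⁴) : T1 u y = (u (y 0) : ℂ) := by
  simp [T1, SchwartzMap.tensorFin_apply]

/-- Values of the two-variable product tensor. [folklore] -/
theorem T2_apply (u v : 𝓢(E⁴, ℝ)) (x : Fin (1 + 1) → E⁴) :
    T2 u v x = (u (x 0) : ℂ) * (v (x 1) : ℂ) := by
  simp [T2, SchwartzMap.tensorFin_apply, Fin.prod_univ_succ]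

/-- `T1 u` is the tensor of `![u]`. [folklore] -/
theorem isTensorOf_T1 (u : 𝓢(E⁴, ℝ)) : IsTensorOf (T1 u) fun i => ofRealTest (![u] i) :=
  isTensorOf_tensorFin _

/-- `T2 u v` is the tensor of `![u, v]`. [folklore] -/
theorem isTensorOf_T2 (u v : 𝓢(E⁴, ℝ)) : IsTensorOf (T2 u v) fun i => ofRealTest (![u, v] i) :=
  isTensorOf_tensorFin _

/-- One-variable test functions are off-diagonal (the coincidence locus of one point is empty). [folklore] -/
theorem isOffDiagonal_one (F : 𝓢((Fin 1 → E⁴), ℂ)) : IsOffDiagonal F := by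
  intro x hx
  obtain ⟨i, j, hij, -⟩ := hx
  exact absurd (Subsingleton.elim i j) hij

/-- Inner composition: `tsupport (f ∘ g) ⊆ g⁻¹(tsupport f)` for continuous `g`. [folklore] -/
theorem tsupport_comp_subset_preimage {X Y M : Type*} [TopologicalSpace X] [TopologicalSpace Y]
    [Zero M] (f : Y → M) {g : X → Y} (hg : Continuous g) :
    tsupport (f ∘ g) ⊆ g ⁻¹' tsupport f :=
  closure_minimal (fun x hx => subset_closure (by simpa [Function.mem_support] using hx))
    ((isClosed_tsupport f).preimage hg)

/-- A time-separated product tensor is off-diagonal. [folklore] -/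
theorem isOffDiagonal_T2 {u v : 𝓢(E⁴, ℝ)} (hu : tsupport (u : E⁴ → ℝ) ⊆ {z | z 0 < 0})
    (hv : tsupport (v : E⁴ → ℝ) ⊆ {z | 0 < z 0}) : IsOffDiagonal (T2 u v) := by
  apply Literature.MathematicalPhysics.AQFT.IsOffDiagonal.of_tsupport_subset
  -- the support lies in the closed set `{x | x 0 ∈ tsupport u, x 1 ∈ tsupport v}`
  have hC : IsClosed {x : Fin (1 + 1) → E⁴ | x 0 ∈ tsupport (u : E⁴ → ℝ) ∧ x 1 ∈ tsupport (v : E⁴ → ℝ)} :=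
    ((isClosed_tsupport _).preimage (continuous_apply 0)).inter
      ((isClosed_tsupport _).preimage (continuous_apply 1))
  have hsupp : Function.support (T2 u v : (Fin (1 + 1) → E⁴) → ℂ) ⊆
      {x | x 0 ∈ tsupport (u : E⁴ → ℝ) ∧ x 1 ∈ tsupport (v : E⁴ → ℝ)} := by
    intro x hx
    rw [Function.mem_support, T2_apply] at hx
    exact ⟨subset_closure (Function.mem_support.2 fun h => hx (by simp [h])),
      subset_closure (Function.mem_support.2 fun h => hx (by simp [h]))⟩
  refine (closure_minimal hsupp hC).trans ?_
  rintro x ⟨hx0, hx1⟩ ⟨i, j, hij, hxij⟩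
  have h01 : x 0 = x 1 := by
    rcases Fin.eq_zero_or_eq_succ i with rfl | ⟨i', rfl⟩
    · have hj : j = 1 := Fin.eq_one_of_ne_zero j (Ne.symm hij)
      rw [hj] at hxij; exact hxij
    · have hi' : i' = 0 := Subsingleton.elim _ _
      subst hi'
      have hj : j = 0 := by
        rcases Fin.eq_zero_or_eq_succ j with rfl | ⟨j', rfl⟩
        · rfl
        · exact absurd (by rw [Subsingleton.elim j' 0]) hij
      rw [hj] at hxij; exact hxij.symm
  have h1 := hu hx0
  have h2 := hv hx1
  simp only [Set.mem_setOf_eq] at h1 h2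
  rw [h01] at h1
  linarith

/-- Time-separated real test functions have pointwise product zero. [folklore] -/
theorem mul_eq_zero_of_tsupport {u v : 𝓢(E⁴, ℝ)} (hu : tsupport (u : E⁴ → ℝ) ⊆ {z | z 0 < 0})
    (hv : tsupport (v : E⁴ → ℝ) ⊆ {z | 0 < z 0}) (z : E⁴) : u z * v z = 0 := by
  by_cases hz : z 0 < 0
  · have : z ∉ tsupport (v : E⁴ → ℝ) := fun h => by have := hv h; simp only [Set.mem_setOf_eq] at this; linarith
    rw [image_eq_zero_of_notMem_tsupport this, mul_zero]
  · have : z ∉ tsupport (u : E⁴ → ℝ) := fun h => hz (hu h)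
    rw [image_eq_zero_of_notMem_tsupport this, zero_mul]

/-! ### Pinning of the continuum two-point function at `β ≡ 0` -/

/-- **At `β ≡ 0` the continuum two-point function of `tr F²` on time-separated real product
tensors factorises**: `𝔖₂(u ⊗ v) = 𝔖₁(u) 𝔖₁(v)` for every OS datum tied to the scheme by
`IsYangMillsFor` (limits of the exactly factorising lattice quantities). [folklore] -/
theorem schwinger_two_eq_mul (r : LatticeRep G) (sch : SpeciesScheme (YMSpecies G))
    (hβ : ∀ k, sch.β k = 0) (ha : ∀ k, sch.a k ≤ 1) (T : OSData (YMSpecies G) 4)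
    (hT : IsYangMillsFor r sch T) {u v : 𝓢(E⁴, ℝ)} (hu : tsupport (u : E⁴ → ℝ) ⊆ {z | z 0 < 0})
    (hv : tsupport (v : E⁴ → ℝ) ⊆ {z | 0 < z 0}) :
    T.schwinger (1 + 1) (fun _ => r.curvature) (T2 u v) =
      T.schwinger 1 (fun _ => r.curvature) (T1 u) * T.schwinger 1 (fun _ => r.curvature) (T1 v) := by
  have h2 := hT (1 + 1) (by norm_num) (fun _ => r.curvature) ![u, v] (T2 u v) (isTensorOf_T2 u v)
    (isOffDiagonal_T2 hu hv)
  have hu1 := hT 1 one_ne_zero (fun _ => r.curvature) ![u] (T1 u) (isTensorOf_T1 u)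
    (isOffDiagonal_one _)
  have hv1 := hT 1 one_ne_zero (fun _ => r.curvature) ![v] (T1 v) (isTensorOf_T1 v)
    (isOffDiagonal_one _)
  have hprod := hu1.mul hv1
  refine tendsto_nhds_unique h2 (hprod.congr' ?_)
  filter_upwards [eventually_le_L sch ha 1] with k hk
  have hL : 1 ≤ sch.L k := by exact_mod_cast hk
  rw [← Complex.ofReal_mul, latticeSchwinger_two_eq_mul r sch (hβ k) hL (mul_eq_zero_of_tsupport hu hv)]

/-! ### The junk model has no non-trivial continuum limit -/

/-- Restriction of a one-variable test function on `(ℝ⁴)¹` to `ℝ⁴`. [folklore] -/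
def toOne (F : 𝓢((Fin 1 → E⁴), ℂ)) : 𝓢(E⁴, ℂ) :=
  SchwartzMap.compCLMOfContinuousLinearEquiv ℝ (ContinuousLinearEquiv.funUnique (Fin 1) ℝ E⁴).symm F

/-- Values of the restriction. [folklore] -/
theorem toOne_apply (F : 𝓢((Fin 1 → E⁴), ℂ)) (e : E⁴) : toOne F e = F (fun _ => e) := by
  simp [toOne, SchwartzMap.compCLMOfContinuousLinearEquiv_apply]
  rfl

/-- A one-point configuration is constant. [folklore] -/
theorem eq_const_of_fin_one (y : Fin 1 → E⁴) : (fun _ => y 0) = y :=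
  funext fun i => by rw [Subsingleton.elim i 0]

/-- A one-variable test function is determined by its restriction. [folklore] -/
theorem apply_eq_toOne (F : 𝓢((Fin 1 → E⁴), ℂ)) (y : Fin 1 → E⁴) : F y = toOne F (y 0) := by
  rw [toOne_apply, eq_const_of_fin_one]

/-- The restriction as a composition. [folklore] -/
theorem coe_toOne (F : 𝓢((Fin 1 → E⁴), ℂ)) :
    (toOne F : E⁴ → ℂ) = (F : (Fin 1 → E⁴) → ℂ) ∘ fun e _ => e := funext (toOne_apply F)

/-- Support of the OS adjoint of a time-ordered one-point function: negative times. [folklore] -/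
theorem tsupport_osAdjoint_subset {F : 𝓢((Fin 1 → E⁴), ℂ)} (hF : IsTimeOrdered F) :
    tsupport (osAdjoint F : (Fin 1 → E⁴) → ℂ) ⊆ {y | y 0 0 < 0} := by
  set R : (Fin 1 → E⁴) → (Fin 1 → E⁴) := fun y i => timeReflection 4 (y (Fin.rev i)) with hR
  have hRc : Continuous R :=
    continuous_pi fun i => (timeReflection 4).continuous.comp (continuous_apply _)
  have hcoe : (osAdjoint F : (Fin 1 → E⁴) → ℂ) = (fun z : ℂ => conj z) ∘ ((F : (Fin 1 → E⁴) → ℂ) ∘ R) :=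
    funext fun y => by simp [hR, osAdjoint_apply]
  rw [hcoe]
  refine (tsupport_comp_subset (map_zero _) _).trans
    ((tsupport_comp_subset_preimage _ hRc).trans fun y hy => ?_)
  have h := (hF hy).1 0
  simp [hR, timeReflection_apply] at h
  simp only [Set.mem_setOf_eq]
  linarith

/-- Support of `toOne (osAdjoint F)`: negative times. [folklore] -/
theorem tsupport_toOne_osAdjoint_subset {F : 𝓢((Fin 1 → E⁴), ℂ)} (hF : IsTimeOrdered F) :
    tsupport (toOne (osAdjoint F) : E⁴ → ℂ) ⊆ {z | z 0 < 0} := by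
  rw [coe_toOne]
  refine (tsupport_comp_subset_preimage _ (continuous_pi fun _ => continuous_id)).trans ?_
  intro e he
  exact tsupport_osAdjoint_subset hF he

/-- Support of `toOne G` for time-ordered `G`: positive times. [folklore] -/
theorem tsupport_toOne_subset {Gt : 𝓢((Fin 1 → E⁴), ℂ)} (hG : IsTimeOrdered Gt) :
    tsupport (toOne Gt : E⁴ → ℂ) ⊆ {z | 0 < z 0} := by
  rw [coe_toOne]
  refine (tsupport_comp_subset_preimage _ (continuous_pi fun _ => continuous_id)).trans ?_
  intro e he
  exact (hG he).1 0

/-- **The ultralocal theory has no non-trivial continuum limit in `tr F²`.** At `β ≡ 0`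
(`a_k ≤ 1`), whatever the renormalisations `c_k, m_k` and torus sizes: every OS datum tied to
the scheme by `IsYangMillsFor` fails `IsNontrivial r.curvature`. (Pinning: `Θ F̄ ⊗ G` is a
combination of four time-separated REAL product tensors, on each of which the two-point function
factorises by `schwinger_two_eq_mul`.) [folklore] -/
theorem not_isNontrivial_beta_zero (r : LatticeRep G) (sch : SpeciesScheme (YMSpecies G))
    (hβ : ∀ k, sch.β k = 0) (ha : ∀ k, sch.a k ≤ 1) (T : OSData (YMSpecies G) 4)
    (hT : IsYangMillsFor r sch T) : ¬ T.IsNontrivial r.curvature := by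
  rintro ⟨F, Gt, H, hF, hG, hH, hne⟩
  apply hne
  set φ := toOne (osAdjoint F) with hφ
  set ψ := toOne Gt with hψ
  have huR : tsupport (reTest φ : E⁴ → ℝ) ⊆ {z | z 0 < 0} :=
    (tsupport_reTest_subset φ).trans (tsupport_toOne_osAdjoint_subset hF)
  have huI : tsupport (imTest φ : E⁴ → ℝ) ⊆ {z | z 0 < 0} :=
    (tsupport_imTest_subset φ).trans (tsupport_toOne_osAdjoint_subset hF)
  have hvR : tsupport (reTest ψ : E⁴ → ℝ) ⊆ {z | 0 < z 0} :=
    (tsupport_reTest_subset ψ).trans (tsupport_toOne_subset hG)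
  have hvI : tsupport (imTest ψ : E⁴ → ℝ) ⊆ {z | 0 < z 0} :=
    (tsupport_imTest_subset ψ).trans (tsupport_toOne_subset hG)
  -- Schwartz-level decompositions
  have e1 : osAdjoint F = T1 (reTest φ) + I • T1 (imTest φ) := by
    ext y
    rw [apply_eq_toOne, add_apply, smul_apply, T1_apply, T1_apply,
      smul_eq_mul, ← reTest_add_imTest_mul_I φ (y 0)]
    ring
  have e2 : Gt = T1 (reTest ψ) + I • T1 (imTest ψ) := by
    ext y
    rw [apply_eq_toOne, add_apply, smul_apply, T1_apply, T1_apply,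
      smul_eq_mul, ← reTest_add_imTest_mul_I ψ (y 0)]
    ring
  have e3 : H = T2 (reTest φ) (reTest ψ) - T2 (imTest φ) (imTest ψ) +
      I • T2 (reTest φ) (imTest ψ) + I • T2 (imTest φ) (reTest ψ) := by
    ext x
    rw [hH x, apply_eq_toOne, apply_eq_toOne Gt]
    simp only [add_apply, sub_apply, smul_apply, T2_apply,
      smul_eq_mul, Function.comp_apply]
    rw [show Fin.castAdd 1 (0 : Fin 1) = (0 : Fin (1 + 1)) from rfl,
      show Fin.natAdd 1 (0 : Fin 1) = (1 : Fin (1 + 1)) from rfl,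
      ← reTest_add_imTest_mul_I φ (x 0), ← reTest_add_imTest_mul_I ψ (x 1)]
    linear_combination ((imTest φ (x 0) : ℂ) * (imTest ψ (x 1) : ℂ)) * Complex.I_sq
  rw [e3, e1, e2]
  simp only [map_add, map_sub, map_smul, smul_eq_mul]
  rw [schwinger_two_eq_mul r sch hβ ha T hT huR hvR, schwinger_two_eq_mul r sch hβ ha T hT huI hvI,
    schwinger_two_eq_mul r sch hβ ha T hT huR hvI, schwinger_two_eq_mul r sch hβ ha T hT huI hvR]
  linear_combination (-((T.schwinger 1 fun _ => r.curvature) (T1 (imTest φ)) *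
    (T.schwinger 1 fun _ => r.curvature) (T1 (imTest ψ)))) * Complex.I_sq

end Pinning

section Assembly

variable {G : Type} [Group G] [TopologicalSpace G] [IsTopologicalGroup G] [CompactSpace G]
  [MeasurableSpace G] [BorelSpace G]

/-- **The ultralocal scheme**: `a_k = M^{-k}`, `β ≡ 0`, `L_k = M^k (k+1)` (so `a_k L_k = k+1`),
renormalisations `0`. [folklore] -/
def ultralocalScheme (ι : Type) {M : ℕ} (hM : 2 ≤ M) : SpeciesScheme ι where
  a k := ((M : ℝ) ^ k)⁻¹
  a_pos k := by positivity
  tendsto_a := tendsto_inv_atTop_zero.comp (tendsto_pow_atTop_atTop_of_one_lt (by exact_mod_cast hM))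
  β _ := 0
  L k := M ^ k * (k + 1)
  tendsto_L := by
    have h : (fun k : ℕ => ((M : ℝ) ^ k)⁻¹ * ((M ^ k * (k + 1) : ℕ) : ℝ)) = fun k : ℕ => (k : ℝ) + 1 := by
      funext k
      have hpos : (0 : ℝ) < (M : ℝ) ^ k := by positivity
      push_cast
      field_simp
    rw [h]
    exact tendsto_natCast_atTop_atTop.atTop_add tendsto_const_nhds
  c _ _ := 0
  m _ _ := 0

/-- **The ultralocal counterexample family (per group, per representation).** For every compact
`G`, faithful unitary `r` and `M ≥ 2`: the scheme `a_k = M^{-k}`, `β ≡ 0` satisfies the M-adic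
shape, the convergence of EVERY `N_t` (to `0`), the tuning clause with `θ = 0`, and the uniform
lattice gap for EVERY `Δ ≥ 0` — while NO renormalisation of it admits OS data that are Yang–Mills
along it and non-trivial in `tr F²`. [folklore] -/
theorem ultralocal_counterexample (r : LatticeRep G) {M : ℕ} (hM : 2 ≤ M) :
    ∃ (sch : SpeciesScheme (YMSpecies G)) (n : ℕ → ℕ),
      (∀ k, sch.a k = ((M : ℝ) ^ n k)⁻¹) ∧ (∀ k, sch.β k = 0) ∧
      (∀ t : ℕ, 0 < t → Tendsto (fun k => ((M : ℝ) ^ n k) ^ 8 *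
        latticeConnectedCorr r.ρ (sch.β k) (sch.side k) r.curvature.F r.curvature.F (t * M ^ n k))
          atTop (𝓝 0)) ∧
      Tendsto (fun k => ((M : ℝ) ^ n k) ^ 8 *
        latticeConnectedCorr r.ρ (sch.β k) (sch.side k) r.curvature.F r.curvature.F (M ^ n k))
          atTop (𝓝 0) ∧
      (∀ Δ : ℝ, 0 ≤ Δ → HasLatticeMassGap r sch Δ) ∧
      ∀ sch' : SpeciesScheme (YMSpecies G), sch'.a = sch.a → sch'.β = sch.β →
        ∀ T : OSData (YMSpecies G) 4, IsYangMillsFor r sch' T → ¬ T.IsNontrivial r.curvature := by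
  have hM1 : 1 ≤ M := by omega
  refine ⟨ultralocalScheme (YMSpecies G) hM, id, fun k => rfl, fun k => rfl, fun t ht => ?_, ?_,
    fun Δ hΔ => ?_, fun sch' ha' hβ' T hT => ?_⟩
  · exact tendsto_N_zero r hM1 _ id (fun k => rfl) (fun k => rfl) ht
  · have h := tendsto_N_zero r hM1 (ultralocalScheme (YMSpecies G) hM) id (fun k => rfl)
      (fun k => rfl) one_pos
    simpa only [one_mul] using h
  · exact hasLatticeMassGap_beta_zero r _ (fun k => rfl) (a_le_one (n := id) hM1 fun k => rfl) hΔ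
  · refine not_isNontrivial_beta_zero r sch' (fun k => ?_) (fun k => ?_) T hT
    · rw [hβ']; rfl
    · rw [ha']; exact a_le_one (sch := ultralocalScheme (YMSpecies G) hM) (n := id) hM1 (fun k => rfl) k

end Assembly

section CruxLevel

open Summit.QuantumFields.YangMills.Theses.ParabolicTrajectory

/-- **(A) without asymptotic freedom implies (A).** The crux `ContinuumLimitOnTrajectory` with the clause
`Tendsto sch.β atTop atTop` DROPPED and the tuning window widened to `0 ≤ θ < θ₀` (everything else verbatim)
implies the crux: it quantifies over more schemes. [folklore] -/
theorem continuumLimitOnTrajectory_of_without_AF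
    (h : ∀ (G : Type) [Group G] [TopologicalSpace G] [IsTopologicalGroup G] [CompactSpace G],
      IsCompactSimpleLieGroup G →
        letI : MeasurableSpace G := borel G
        haveI : BorelSpace G := ⟨rfl⟩
        ∀ (r : LatticeRep G), ∃ M₀ : ℕ, ∀ M : ℕ, M₀ ≤ M → 2 ≤ M → ∃ θ₀ : ℝ, 0 < θ₀ ∧
          ∀ (θ Δ : ℝ) (sch : SpeciesScheme (YMSpecies G)) (n : ℕ → ℕ),
            0 ≤ θ → θ < θ₀ → 0 < Δ → (∀ k, sch.a k = ((M : ℝ) ^ n k)⁻¹) →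
            (∀ t : ℕ, 0 < t → ∃ c : ℝ, Tendsto (fun k => ((M : ℝ) ^ n k) ^ 8 *
              latticeConnectedCorr r.ρ (sch.β k) (sch.side k) r.curvature.F r.curvature.F
                (t * M ^ n k)) atTop (𝓝 c)) →
            Tendsto (fun k => ((M : ℝ) ^ n k) ^ 8 *
              latticeConnectedCorr r.ρ (sch.β k) (sch.side k) r.curvature.F r.curvature.F (M ^ n k))
                atTop (𝓝 θ) →
            HasLatticeMassGap r sch Δ →
              ∃ sch' : SpeciesScheme (YMSpecies G), sch'.a = sch.a ∧ sch'.β = sch.β ∧ sch'.L = sch.L ∧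
                ∃ T : OSData (YMSpecies G) 4,
                  IsYangMillsFor r sch' T ∧ T.IsNontrivial r.curvature ∧ T.IsNonGaussian r.curvature) :
    ContinuumLimitOnTrajectory := by
  intro G _ _ _ _ hG r
  obtain ⟨M₀, hM₀⟩ := h G hG r
  refine ⟨M₀, fun M hM h2 => ?_⟩
  obtain ⟨θ₀, hθ₀, hθ⟩ := hM₀ M hM h2
  exact ⟨θ₀, hθ₀, fun θ Δ sch n h0 h1 hΔ ha _ hconv htune hgap =>
    hθ θ Δ sch n h0.le h1 hΔ ha hconv htune hgap⟩

/-- **Load-bearing pair {asymptotic-freedom clause, `θ > 0`}: (A) without them is FALSE.** The crux with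
`Tendsto sch.β atTop atTop` dropped and `0 < θ` widened to `0 ≤ θ` fails on `G = SU(2)` (simple:
`isSimpleCompactGroup_specialUnitaryGroup_holds`) with its fundamental representation: the ultralocal scheme
`a_k = M^{-k}`, `β ≡ 0` (`ultralocal_counterexample`) meets every hypothesis with `θ = 0`, `Δ = 1`, and no
renormalisation of it carries non-trivial Yang–Mills OS data (`not_isNontrivial_beta_zero`). [folklore] -/
theorem continuumLimitOnTrajectory_false_without_AF :
    ¬ ∀ (G : Type) [Group G] [TopologicalSpace G] [IsTopologicalGroup G] [CompactSpace G],
      IsCompactSimpleLieGroup G →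
        letI : MeasurableSpace G := borel G
        haveI : BorelSpace G := ⟨rfl⟩
        ∀ (r : LatticeRep G), ∃ M₀ : ℕ, ∀ M : ℕ, M₀ ≤ M → 2 ≤ M → ∃ θ₀ : ℝ, 0 < θ₀ ∧
          ∀ (θ Δ : ℝ) (sch : SpeciesScheme (YMSpecies G)) (n : ℕ → ℕ),
            0 ≤ θ → θ < θ₀ → 0 < Δ → (∀ k, sch.a k = ((M : ℝ) ^ n k)⁻¹) →
            (∀ t : ℕ, 0 < t → ∃ c : ℝ, Tendsto (fun k => ((M : ℝ) ^ n k) ^ 8 *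
              latticeConnectedCorr r.ρ (sch.β k) (sch.side k) r.curvature.F r.curvature.F
                (t * M ^ n k)) atTop (𝓝 c)) →
            Tendsto (fun k => ((M : ℝ) ^ n k) ^ 8 *
              latticeConnectedCorr r.ρ (sch.β k) (sch.side k) r.curvature.F r.curvature.F (M ^ n k))
                atTop (𝓝 θ) →
            HasLatticeMassGap r sch Δ →
              ∃ sch' : SpeciesScheme (YMSpecies G), sch'.a = sch.a ∧ sch'.β = sch.β ∧ sch'.L = sch.L ∧
                ∃ T : OSData (YMSpecies G) 4,
                  IsYangMillsFor r sch' T ∧ T.IsNontrivial r.curvature ∧ T.IsNonGaussian r.curvature := by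
  intro h
  have hG : IsCompactSimpleLieGroup (Matrix.specialUnitaryGroup (Fin 2) ℂ) :=
    isCompactSimpleLieGroup_specialUnitaryGroup isSimpleCompactGroup_specialUnitaryGroup_holds le_rfl
  letI : MeasurableSpace (Matrix.specialUnitaryGroup (Fin 2) ℂ) := borel _
  haveI : BorelSpace (Matrix.specialUnitaryGroup (Fin 2) ℂ) := ⟨rfl⟩
  obtain ⟨r⟩ := hG.2
  obtain ⟨M₀, hM₀⟩ := h _ hG r
  obtain ⟨θ₀, hθ₀, hθ⟩ := hM₀ (max M₀ 2) (le_max_left _ _) (le_max_right _ _)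
  obtain ⟨sch, n, ha, hβ, hconv, htune, hgap, hno⟩ :=
    ultralocal_counterexample r (M := max M₀ 2) (le_max_right _ _)
  obtain ⟨sch', ha', hβ', -, T, hYM, hNT, -⟩ := hθ 0 1 sch n le_rfl hθ₀ one_pos ha
    (fun t ht => ⟨0, hconv t ht⟩) htune (hgap 1 zero_le_one)
  exact hno sch' ha' hβ' T hYM hNT

end CruxLevel

end

end Summit.QuantumFields.YangMills.Theorems.ContinuumLimitOnTrajectory.Negative
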